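import Summits.QuantumFields.BalabanUV.Beta.FP.PeriodisedBorderTablesRecord
import Literature.MathematicalPhysics.QuantumFieldTheory.Balaban1983to89.Beta.BorderedJets

/-!
# `BalabanUV.Beta.FP.PeriodisedBorderTablesSlots` — road «FP» for binder row D1, ROUTE T row **(T-ID)**, border-table half IN THE SLOT-MAP PRESENTATION OF
# RECORD: read through leaf-05's slot maps `fν : ν → Idx M (Fib d)` (into FIELD slots) and `fμ : μ → Idx M (Fib d)` (into MULTIPLIER slots), a torus border
# jet `X = perF M (dper M (packK N T κ u))` (or a finite bond-weighted sum of such) is a **PURE BORDER**: `X∘(fν,fν) = 0`, `X∘(fμ,fμ) = 0`, `X∘(fν,fμ) = (X∘(fμ,fν))ᵀ`,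
# hence `X∘(fν ⊕ fμ, fν ⊕ fμ) = kkt 0 Q` with `Q := X∘(fμ,fν)` — the `kkt _ (fromRows Q 0)` words of the OWNER's one-shot step law (p308750 ∕ p311088: `hB : fromRows Q₁₁ 0 = B`,
# `fromRows Q₁₂ 0`, `fromRows Q₂ₖ 0`) by `kkt`-additivity

HONEST DEPENDENCY (page 1, mandatory): continuum YM on T⁴ ⇐ BetaPertH ∧ nine spine estimates (0/9 proved); BetaPertH ⇐ (D1) ∧ (D4) ∧ CAP+tail;
G-an2-4 gates asym, D1 and NE2/3/4.  HONEST FRAMING (cell contract, verbatim): «discharging `BetaPertH` makes Bałaban's UV stability UNCONDITIONAL —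
a real constructive-QFT result; it is NOT the continuum limit and NOT the Clay problem.»  ABSOLUTE RULE (cell charter, verbatim): «No internally-minted
statement may enter as a cited fact. Every hypothesis is either kernel-proved in this package or a verbatim quotation of a PUBLISHED theorem with page
reference. The manuscript(s) under audit are NOT citable for their own disputed steps — they are the thing under adjudication; programme-internal
(2001/route/tribunal) claims are never citable.»  THIS MODULE is [folklore] finite-matrix bookkeeping (`Matrix.submatrix` ∕ `fromBlocks` ∕ `fromRows`, an5's `kkt`,
`BorderedJets.kkt_add`) over leaf-02's `PeriodisedBorderTables` §3∕§5∕§6 and `PeriodisedBorderTablesRecord` §4; no `def`, no `def … : Prop`, nothing cited, 0 sorry;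
0 estimates; 0∕4 row-D1 binders; NOT (T-ID) itself (WHICH slot maps, WHICH tables and WHICH bond weights `w` the instance uses is the OWNER's
`FP/NestedStepLawTorusInstance` ∕ the dictionary's — an2's averaging jets `h̄₁ h̄₂` for the coarse weights), NOT (T-INV), NOT SDF, NOT D1, NOT BetaPertH,
NOT continuum, NOT Clay.  «not in print; our bookkeeping».

WHY (OWNER d1-p3 g17, W-FP-17-8 (B)(C), journal 2026-08-22 [D1P3-G17-W8]: «THIS SHAPE — GO … the `kkt 0 (fromRows Q₁ₖ 0)` words by `kkt`-additivity are exactly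
what `hB : fromRows Q₁₁ 0 = B` and the `fromRows Q₁₂ 0` slots of p308750∕p311088 want; please state (S4) ALSO on the coarse torus `M′` … `Q₂ₖ(w̄) := Σ_b̄ w̄(b̄) •
(perF M′ (dper M′ (packK … b̄))).submatrix fμ′ fν′`»).  Every theorem below is stated for an ARBITRARY torus `M` and an arbitrary finite family of packed tables
with weights, so it is read at `(M, N := Lc)` for the fine border slots `Q₁₁ Q₁₂` and at `(M′, N := Lc, coarse tables, w := w̄)` for the coarse border slots
`Q₂₁(w̄) Q₂₂(w̄)` verbatim (§4); the slot maps are leaf-05's (`RelInvPeriodisedSliced.torus_isUnit_det_kkt_of_slots`, `RelInvPeriodisedCombRows`).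

CONTENT.
* §1 generic (any `M`, any real matrix `X` on `Idx M (Fib d)`, any slot maps with `hν : (fν b).2 = inl _`, `hμ : (fμ a).2 = inr _`): from the three PURE-BORDER
  letters ff = 0 (`hff`), mm = 0 (`hmm`), `Xᵀ = X` (`hsym`): (S1) `X.submatrix fν fν = 0`, (S2) `X.submatrix fμ fμ = 0`, (S3) `X.submatrix fν fμ = (X.submatrix fμ fν)ᵀ`,
  **(S4) `X.submatrix (Sum.elim fν fμ) (Sum.elim fν fμ) = kkt 0 (X.submatrix fμ fν)`**; and the FORM ⊕ BORDER split (S6): if `Y` has field–field entries only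
  (`hfo`), `(Y + X).submatrix fν fν = Y.submatrix fν fν`, `(Y + X).submatrix fμ fν = X.submatrix fμ fν`, `(Y + X).submatrix (fν ⊕ fμ) (fν ⊕ fμ) = kkt (Y∘(fν,fν)) (X∘(fμ,fν))`.
* §2 the three letters for ONE torus border table `perF M (dper M (packK N T κ u))` (no hypothesis on `T`; `PeriodisedBorderTables` §3 + `perF_dper_packK_transpose`)
  and for a FINITE BOND-WEIGHTED SUM `Σ_{i ∈ s} w i • perF M (dper M (packK N (T i) (κ i) (u i)))` (letters are linear); hence (S1)–(S4) for both, and the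
  presented border rows of the sum are the weighted sum of the presented rows (`submatrix_weighted`).
* §3 (S5) DEAD ROWS in slot-map form: a multiplier slot `fμ a` OFF the `N`-sublattice carries a zero row of `Q := X.submatrix fμ fν` (`M = N·M′`;
  `PeriodisedBorderTablesSorted` §2 read through `fμ`), for one table and for the weighted sum.
* §4 AT THE RECORD: the composite border tables `VComp … m` (`m ≠ 1`, a packing by `VComp_of_ne_one`) — (S1)–(S4) verbatim.
* §5 the `fromRows _ 0` words: `fromRows_add_add`, `fromRows_smul_zero`, **`kkt_add_slice`** `kkt (H + H') (fromRows (Q + Q') τ) = kkt H (fromRows Q τ) + kkt H' (fromRows Q' 0)`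
  (static slice rows have zero jets), `kkt_smul_slice`, and the 2-jet line `kkt_line_slice`.
NOT HERE: the choice of `fν fμ`, of the tables and of the weights; the form-table jets `H₁ H₂`; any identification with Bałaban's objects.
Provenance: D1 formalisation swarm LEAF PROVER 02, unit b2b-balaban-beta-d1-formalise-leaf-02 gen 17, 2026-08-22 (OFFER O-d1leaf02g17-1, OWNER GO W-FP-17-8).  No existing file touched.
-/

noncomputable section

open scoped BigOperators

namespace Summit.QuantumFields.BalabanUV.Beta.FP.PeriodisedBorderTablesSlots

open Matrix
open Literature.MathematicalPhysics.QuantumFieldTheory.Balaban1983to89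
open Literature.MathematicalPhysics.QuantumFieldTheory.Balaban1983to89.Beta
open Literature.MathematicalPhysics.QuantumFieldTheory.Balaban1983to89.Beta.Composition (kkt)
open Literature.MathematicalPhysics.QuantumFieldTheory.Balaban1983to89.Beta.BorderedJets (kkt_add kkt_smul)
open B6Lemma24Torus (pbox)
open ExpKernelCalculus (MKer)
open AffineAveraging (Site)
open AveragingContours (off)
open OneStepResolventKernel (Fib)
open Summit.QuantumFields.BalabanUV.Beta.FP.KernelPeriodisationFib (perF perF_apply Idx)
open Summit.QuantumFields.BalabanUV.Beta.FP.KernelPeriodisationFibLoc (dper)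
open Summit.QuantumFields.BalabanUV.Beta.FP.CompositeBorderTables (packK VComp VComp_of_ne_one)
open Summit.QuantumFields.BalabanUV.Beta.FP.PeriodisedBorderTables (perZ_dper_packK_inl_inl perZ_dper_packK_inr_inr perF_dper_packK_transpose
  perZ_dper_packK_inr_inl_of_off_ne_zero)

variable {d : ℕ}

/-! ## §1 Generic: a pure-border matrix read through field ∕ multiplier slot maps -/

section Generic

variable {M : Fin (d + 1) → ℕ} {ν μ : Type*} (X Y : Matrix (Idx M (Fib d)) (Idx M (Fib d)) ℝ)
  (fν : ν → Idx M (Fib d)) (fμ : μ → Idx M (Fib d))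

/-- [folklore] **(S1)** a matrix with no field–field entries has a zero `(fν, fν)` block. -/
theorem submatrix_field_field_eq_zero
    (hff : ∀ (p q : Idx M (Fib d)) (α α' : Fin (d + 1)), p.2 = Sum.inl α → q.2 = Sum.inl α' → X p q = 0)
    (hν : ∀ b : ν, ∃ α : Fin (d + 1), (fν b).2 = Sum.inl α) : X.submatrix fν fν = 0 := by
  ext b b'
  obtain ⟨α, hα⟩ := hν b
  obtain ⟨α', hα'⟩ := hν b'
  exact hff _ _ α α' hα hα'

/-- [folklore] **(S2)** a matrix with no multiplier–multiplier entries has a zero `(fμ, fμ)` block. -/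
theorem submatrix_mult_mult_eq_zero
    (hmm : ∀ (p q : Idx M (Fib d)) (ρ ρ' : Fin (d + 1)), p.2 = Sum.inr ρ → q.2 = Sum.inr ρ' → X p q = 0)
    (hμ : ∀ a : μ, ∃ ρ : Fin (d + 1), (fμ a).2 = Sum.inr ρ) : X.submatrix fμ fμ = 0 := by
  ext a a'
  obtain ⟨ρ, hρ⟩ := hμ a
  obtain ⟨ρ', hρ'⟩ := hμ a'
  exact hmm _ _ ρ ρ' hρ hρ'

/-- [folklore] **(S3)** for a symmetric matrix the `(fν, fμ)` block is the transpose of the `(fμ, fν)` block (no slot hypothesis). -/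
theorem submatrix_field_mult_eq_transpose (hsym : Xᵀ = X) : X.submatrix fν fμ = (X.submatrix fμ fν)ᵀ := by
  ext b a
  rw [transpose_apply, submatrix_apply, submatrix_apply, ← hsym, transpose_apply, hsym]

/-- [folklore] **(S4) A PURE-BORDER MATRIX PRESENTED ON `fν ⊕ fμ` IS `kkt 0 Q` with `Q := X.submatrix fμ fν`.** -/
theorem submatrix_slots_eq_kkt
    (hff : ∀ (p q : Idx M (Fib d)) (α α' : Fin (d + 1)), p.2 = Sum.inl α → q.2 = Sum.inl α' → X p q = 0)
    (hmm : ∀ (p q : Idx M (Fib d)) (ρ ρ' : Fin (d + 1)), p.2 = Sum.inr ρ → q.2 = Sum.inr ρ' → X p q = 0)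
    (hsym : Xᵀ = X)
    (hν : ∀ b : ν, ∃ α : Fin (d + 1), (fν b).2 = Sum.inl α) (hμ : ∀ a : μ, ∃ ρ : Fin (d + 1), (fμ a).2 = Sum.inr ρ) :
    X.submatrix (Sum.elim fν fμ) (Sum.elim fν fμ) = kkt (0 : Matrix ν ν ℝ) (X.submatrix fμ fν) := by
  have h1 := submatrix_field_field_eq_zero X fν hff hν
  have h2 := submatrix_mult_mult_eq_zero X fμ hmm hμ
  have h3 := submatrix_field_mult_eq_transpose X fν fμ hsym
  ext (b | a) (b' | a')
  · simpa only [submatrix_apply, Sum.elim_inl, kkt, fromBlocks_apply₁₁, Matrix.zero_apply] using congrFun (congrFun h1 b) b'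
  · simpa only [submatrix_apply, Sum.elim_inl, Sum.elim_inr, kkt, fromBlocks_apply₁₂, transpose_apply] using congrFun (congrFun h3 b) a'
  · simp only [submatrix_apply, Sum.elim_inl, Sum.elim_inr, kkt, fromBlocks_apply₂₁]
  · simpa only [submatrix_apply, Sum.elim_inr, kkt, fromBlocks_apply₂₂, Matrix.zero_apply] using congrFun (congrFun h2 a) a'

/-- [folklore] **(S6) FORM ⊕ BORDER SPLIT**: a field–field matrix `Y` (`hfo`: every entry with a multiplier index vanishes) plus a pure border `X`, presented on
`fν ⊕ fμ`, is `kkt (Y∘(fν,fν)) (X∘(fμ,fν))`; the two presented blocks are read off the summands separately. -/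
theorem submatrix_slots_form_add_border
    (hfo : ∀ (p q : Idx M (Fib d)), ((∃ ρ, p.2 = Sum.inr ρ) ∨ (∃ ρ, q.2 = Sum.inr ρ)) → Y p q = 0)
    (hff : ∀ (p q : Idx M (Fib d)) (α α' : Fin (d + 1)), p.2 = Sum.inl α → q.2 = Sum.inl α' → X p q = 0)
    (hmm : ∀ (p q : Idx M (Fib d)) (ρ ρ' : Fin (d + 1)), p.2 = Sum.inr ρ → q.2 = Sum.inr ρ' → X p q = 0)
    (hsym : Xᵀ = X)
    (hν : ∀ b : ν, ∃ α : Fin (d + 1), (fν b).2 = Sum.inl α) (hμ : ∀ a : μ, ∃ ρ : Fin (d + 1), (fμ a).2 = Sum.inr ρ) :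
    (Y + X).submatrix fν fν = Y.submatrix fν fν ∧ (Y + X).submatrix fμ fν = X.submatrix fμ fν ∧
      (Y + X).submatrix (Sum.elim fν fμ) (Sum.elim fν fμ) = kkt (Y.submatrix fν fν) (X.submatrix fμ fν) := by
  have hYs : Y.submatrix (Sum.elim fν fμ) (Sum.elim fν fμ) = kkt (Y.submatrix fν fν) (0 : Matrix μ ν ℝ) := by
    ext (b | a) (b' | a')
    · simp only [submatrix_apply, Sum.elim_inl, kkt, fromBlocks_apply₁₁]
    · obtain ⟨ρ, hρ⟩ := hμ a'
      simp only [submatrix_apply, Sum.elim_inl, Sum.elim_inr, kkt, fromBlocks_apply₁₂, transpose_zero, Matrix.zero_apply]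
      exact hfo _ _ (Or.inr ⟨ρ, hρ⟩)
    · obtain ⟨ρ, hρ⟩ := hμ a
      simp only [submatrix_apply, Sum.elim_inl, Sum.elim_inr, kkt, fromBlocks_apply₂₁, Matrix.zero_apply]
      exact hfo _ _ (Or.inl ⟨ρ, hρ⟩)
    · obtain ⟨ρ, hρ⟩ := hμ a
      simp only [submatrix_apply, Sum.elim_inr, kkt, fromBlocks_apply₂₂, Matrix.zero_apply]
      exact hfo _ _ (Or.inl ⟨ρ, hρ⟩)
  refine ⟨?_, ?_, ?_⟩
  · rw [submatrix_add, Pi.add_apply, Pi.add_apply, submatrix_field_field_eq_zero X fν hff hν, add_zero]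
  · ext a b
    obtain ⟨ρ, hρ⟩ := hμ a
    rw [submatrix_apply, Matrix.add_apply, submatrix_apply, hfo _ _ (Or.inl ⟨ρ, hρ⟩), zero_add]
  · rw [submatrix_add, Pi.add_apply, Pi.add_apply, hYs, submatrix_slots_eq_kkt X fν fμ hff hmm hsym hν hμ, ← kkt_add, add_zero, zero_add]

end Generic

/-! ## §2 The three pure-border letters of the torus border tables, one table and a finite bond-weighted sum -/

section Border

variable (M : Fin (d + 1) → ℕ) {N : ℕ} {ν μ ι : Type*} (fν : ν → Idx M (Fib d)) (fμ : μ → Idx M (Fib d))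

/-- [folklore] ff = 0 for one torus border table (no hypothesis on `T`). -/
theorem hff_perF_dper_packK (T : Fin (d + 1) → Site (d + 1) → MKer (d + 1) (Fib d)) (κ : Fin (d + 1)) (u : Site (d + 1))
    (p q : Idx M (Fib d)) (α α' : Fin (d + 1)) (hp : p.2 = Sum.inl α) (hq : q.2 = Sum.inl α') :
    perF M (dper M (packK N T κ u)) p q = 0 := by
  rw [perF_apply, hp, hq]; exact perZ_dper_packK_inl_inl T κ u _ _ α α'

/-- [folklore] mm = 0 for one torus border table. -/
theorem hmm_perF_dper_packK (T : Fin (d + 1) → Site (d + 1) → MKer (d + 1) (Fib d)) (κ : Fin (d + 1)) (u : Site (d + 1))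
    (p q : Idx M (Fib d)) (ρ ρ' : Fin (d + 1)) (hp : p.2 = Sum.inr ρ) (hq : q.2 = Sum.inr ρ') :
    perF M (dper M (packK N T κ u)) p q = 0 := by
  rw [perF_apply, hp, hq]; exact perZ_dper_packK_inr_inr T κ u _ _ ρ ρ'

/-- [folklore] ff = 0 for a finite bond-weighted sum of torus border tables (entrywise, no convergence). -/
theorem hff_weighted (s : Finset ι) (w : ι → ℝ) (T : ι → Fin (d + 1) → Site (d + 1) → MKer (d + 1) (Fib d)) (κ : ι → Fin (d + 1)) (u : ι → Site (d + 1))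
    (p q : Idx M (Fib d)) (α α' : Fin (d + 1)) (hp : p.2 = Sum.inl α) (hq : q.2 = Sum.inl α') :
    (∑ i ∈ s, w i • perF M (dper M (packK N (T i) (κ i) (u i)))) p q = 0 := by
  rw [Matrix.sum_apply]
  exact Finset.sum_eq_zero fun i _ => by rw [Matrix.smul_apply, hff_perF_dper_packK M (T i) (κ i) (u i) p q α α' hp hq, smul_zero]

/-- [folklore] mm = 0 for a finite bond-weighted sum. -/
theorem hmm_weighted (s : Finset ι) (w : ι → ℝ) (T : ι → Fin (d + 1) → Site (d + 1) → MKer (d + 1) (Fib d)) (κ : ι → Fin (d + 1)) (u : ι → Site (d + 1))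
    (p q : Idx M (Fib d)) (ρ ρ' : Fin (d + 1)) (hp : p.2 = Sum.inr ρ) (hq : q.2 = Sum.inr ρ') :
    (∑ i ∈ s, w i • perF M (dper M (packK N (T i) (κ i) (u i)))) p q = 0 := by
  rw [Matrix.sum_apply]
  exact Finset.sum_eq_zero fun i _ => by rw [Matrix.smul_apply, hmm_perF_dper_packK M (T i) (κ i) (u i) p q ρ ρ' hp hq, smul_zero]

/-- [folklore] symmetry for a finite bond-weighted sum (`perF_dper_packK_transpose` termwise). -/
theorem transpose_weighted (s : Finset ι) (w : ι → ℝ) (T : ι → Fin (d + 1) → Site (d + 1) → MKer (d + 1) (Fib d)) (κ : ι → Fin (d + 1)) (u : ι → Site (d + 1)) :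
    (∑ i ∈ s, w i • perF M (dper M (packK N (T i) (κ i) (u i))))ᵀ = ∑ i ∈ s, w i • perF M (dper M (packK N (T i) (κ i) (u i))) := by
  rw [transpose_sum]
  exact Finset.sum_congr rfl fun i _ => by rw [transpose_smul, perF_dper_packK_transpose M (T i) (κ i) (u i)]

variable (hν : ∀ b : ν, ∃ α : Fin (d + 1), (fν b).2 = Sum.inl α) (hμ : ∀ a : μ, ∃ ρ : Fin (d + 1), (fμ a).2 = Sum.inr ρ)
include hν in
/-- [folklore] **(S1) for one torus border table.** -/
theorem perF_dper_packK_submatrix_field_field (T : Fin (d + 1) → Site (d + 1) → MKer (d + 1) (Fib d)) (κ : Fin (d + 1)) (u : Site (d + 1)) :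
    (perF M (dper M (packK N T κ u))).submatrix fν fν = 0 :=
  submatrix_field_field_eq_zero _ fν (hff_perF_dper_packK M T κ u) hν

include hμ in
/-- [folklore] **(S2) for one torus border table.** -/
theorem perF_dper_packK_submatrix_mult_mult (T : Fin (d + 1) → Site (d + 1) → MKer (d + 1) (Fib d)) (κ : Fin (d + 1)) (u : Site (d + 1)) :
    (perF M (dper M (packK N T κ u))).submatrix fμ fμ = 0 :=
  submatrix_mult_mult_eq_zero _ fμ (hmm_perF_dper_packK M T κ u) hμ

/-- [folklore] **(S3) for one torus border table** (no slot hypothesis). -/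
theorem perF_dper_packK_submatrix_field_mult (T : Fin (d + 1) → Site (d + 1) → MKer (d + 1) (Fib d)) (κ : Fin (d + 1)) (u : Site (d + 1)) :
    (perF M (dper M (packK N T κ u))).submatrix fν fμ = ((perF M (dper M (packK N T κ u))).submatrix fμ fν)ᵀ :=
  submatrix_field_mult_eq_transpose _ fν fμ (perF_dper_packK_transpose M T κ u)

include hν hμ in
/-- [folklore] **(S4) for one torus border table: presented on `fν ⊕ fμ` it is `kkt 0 Q`, `Q := X∘(fμ,fν)`.** -/
theorem perF_dper_packK_submatrix_slots (T : Fin (d + 1) → Site (d + 1) → MKer (d + 1) (Fib d)) (κ : Fin (d + 1)) (u : Site (d + 1)) :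
    (perF M (dper M (packK N T κ u))).submatrix (Sum.elim fν fμ) (Sum.elim fν fμ)
      = kkt (0 : Matrix ν ν ℝ) ((perF M (dper M (packK N T κ u))).submatrix fμ fν) :=
  submatrix_slots_eq_kkt _ fν fμ (hff_perF_dper_packK M T κ u) (hmm_perF_dper_packK M T κ u) (perF_dper_packK_transpose M T κ u) hν hμ

include hν in
/-- [folklore] **(S1) for a finite bond-weighted sum.** -/
theorem weighted_submatrix_field_field (s : Finset ι) (w : ι → ℝ) (T : ι → Fin (d + 1) → Site (d + 1) → MKer (d + 1) (Fib d)) (κ : ι → Fin (d + 1))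
    (u : ι → Site (d + 1)) : (∑ i ∈ s, w i • perF M (dper M (packK N (T i) (κ i) (u i)))).submatrix fν fν = 0 :=
  submatrix_field_field_eq_zero _ fν (hff_weighted M s w T κ u) hν

include hμ in
/-- [folklore] **(S2) for a finite bond-weighted sum.** -/
theorem weighted_submatrix_mult_mult (s : Finset ι) (w : ι → ℝ) (T : ι → Fin (d + 1) → Site (d + 1) → MKer (d + 1) (Fib d)) (κ : ι → Fin (d + 1))
    (u : ι → Site (d + 1)) : (∑ i ∈ s, w i • perF M (dper M (packK N (T i) (κ i) (u i)))).submatrix fμ fμ = 0 :=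
  submatrix_mult_mult_eq_zero _ fμ (hmm_weighted M s w T κ u) hμ

/-- [folklore] **(S3) for a finite bond-weighted sum.** -/
theorem weighted_submatrix_field_mult (s : Finset ι) (w : ι → ℝ) (T : ι → Fin (d + 1) → Site (d + 1) → MKer (d + 1) (Fib d)) (κ : ι → Fin (d + 1))
    (u : ι → Site (d + 1)) :
    (∑ i ∈ s, w i • perF M (dper M (packK N (T i) (κ i) (u i)))).submatrix fν fμ
      = ((∑ i ∈ s, w i • perF M (dper M (packK N (T i) (κ i) (u i)))).submatrix fμ fν)ᵀ :=
  submatrix_field_mult_eq_transpose _ fν fμ (transpose_weighted M s w T κ u)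

include hν hμ in
/-- [folklore] **(S4) FOR A FINITE BOND-WEIGHTED SUM OF TORUS BORDER TABLES — the background jets `Q₁ₖ` (fine torus) and, read at the coarse torus with the
dictionary's coarse weights `w̄`, `Q₂ₖ(w̄)`: presented on `fν ⊕ fμ` the jet is `kkt 0 Q`, `Q := X∘(fμ,fν)`.** -/
theorem weighted_submatrix_slots (s : Finset ι) (w : ι → ℝ) (T : ι → Fin (d + 1) → Site (d + 1) → MKer (d + 1) (Fib d)) (κ : ι → Fin (d + 1))
    (u : ι → Site (d + 1)) :
    (∑ i ∈ s, w i • perF M (dper M (packK N (T i) (κ i) (u i)))).submatrix (Sum.elim fν fμ) (Sum.elim fν fμ)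
      = kkt (0 : Matrix ν ν ℝ) ((∑ i ∈ s, w i • perF M (dper M (packK N (T i) (κ i) (u i)))).submatrix fμ fν) :=
  submatrix_slots_eq_kkt _ fν fμ (hff_weighted M s w T κ u) (hmm_weighted M s w T κ u) (transpose_weighted M s w T κ u) hν hμ

/-- [folklore] the presented rows of the weighted sum are the weighted sum of the presented rows (`submatrix` is linear). -/
theorem submatrix_weighted (s : Finset ι) (w : ι → ℝ) (X : ι → Matrix (Idx M (Fib d)) (Idx M (Fib d)) ℝ) :
    (∑ i ∈ s, w i • X i).submatrix fμ fν = ∑ i ∈ s, w i • (X i).submatrix fμ fν := by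
  ext a b
  simp only [submatrix_apply, Matrix.sum_apply, Matrix.smul_apply]

end Border

/-! ## §3 (S5) Dead rows in slot-map form: off-sublattice multiplier slots carry zero rows -/

section DeadRows

variable {M M' : Fin (d + 1) → ℕ} {N : ℕ} {ν μ ι : Type*} (fν : ν → Idx M (Fib d)) (fμ : μ → Idx M (Fib d))

/-- [folklore] **(S5)** a multiplier slot `fμ a` OFF the `N`-sublattice carries a zero row of `Q := X∘(fμ,fν)` for one torus border table (`M = N·M′`; column
slot a field slot). -/
theorem perF_dper_packK_submatrix_row_eq_zero (hM : ∀ i, M i = N * M' i)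
    (hν : ∀ b : ν, ∃ α : Fin (d + 1), (fν b).2 = Sum.inl α)
    (T : Fin (d + 1) → Site (d + 1) → MKer (d + 1) (Fib d)) (κ : Fin (d + 1)) (u : Site (d + 1))
    (a : μ) {ρ : Fin (d + 1)} (ha : (fμ a).2 = Sum.inr ρ) (hoff : off N ((fμ a).1 : Site (d + 1)) ≠ 0) (b : ν) :
    (perF M (dper M (packK N T κ u))).submatrix fμ fν a b = 0 := by
  obtain ⟨α, hα⟩ := hν b
  rw [submatrix_apply, perF_apply, ha, hα]
  exact perZ_dper_packK_inr_inl_of_off_ne_zero T κ u hM hoff _ ρ α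

/-- [folklore] **(S5) for a finite bond-weighted sum.** -/
theorem weighted_submatrix_row_eq_zero (hM : ∀ i, M i = N * M' i)
    (hν : ∀ b : ν, ∃ α : Fin (d + 1), (fν b).2 = Sum.inl α)
    (s : Finset ι) (w : ι → ℝ) (T : ι → Fin (d + 1) → Site (d + 1) → MKer (d + 1) (Fib d)) (κ : ι → Fin (d + 1)) (u : ι → Site (d + 1))
    (a : μ) {ρ : Fin (d + 1)} (ha : (fμ a).2 = Sum.inr ρ) (hoff : off N ((fμ a).1 : Site (d + 1)) ≠ 0) (b : ν) :
    (∑ i ∈ s, w i • perF M (dper M (packK N (T i) (κ i) (u i)))).submatrix fμ fν a b = 0 := by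
  rw [submatrix_weighted M fν fμ s w, Matrix.sum_apply]
  exact Finset.sum_eq_zero fun i _ => by
    rw [Matrix.smul_apply, perF_dper_packK_submatrix_row_eq_zero fν fμ hM hν (T i) (κ i) (u i) a ha hoff b, smul_zero]

end DeadRows

/-! ## §4 At the record: the composite border tables `VComp … m`, `m ≠ 1` -/

section Record

variable (M : Fin (d + 1) → ℕ) (Lc : ℕ) {ν μ : Type*} (fν : ν → Idx M (Fib d)) (fμ : μ → Idx M (Fib d))
  (q : Fin (d + 1) → Site (d + 1) → Fin (d + 1) → Site (d + 1) → ℝ) (lam : ℝ)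
  (V : Fin (d + 1) → Site (d + 1) → MKer (d + 1) (Fib d)) {m : ℕ}

/-- [our object — bookkeeping] **(S4) FOR THE COMPOSITE BORDER TABLE OF RECORD** `VComp Lc q lam V m` (`m ≠ 1`): presented on `fν ⊕ fμ` its torus jet is `kkt 0 Q`. -/
theorem perF_dper_VComp_submatrix_slots (hm : m ≠ 1)
    (hν : ∀ b : ν, ∃ α : Fin (d + 1), (fν b).2 = Sum.inl α) (hμ : ∀ a : μ, ∃ ρ : Fin (d + 1), (fμ a).2 = Sum.inr ρ)
    (κ : Fin (d + 1)) (u : Site (d + 1)) :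
    (perF M (dper M (VComp Lc q lam V m κ u))).submatrix (Sum.elim fν fμ) (Sum.elim fν fμ)
      = kkt (0 : Matrix ν ν ℝ) ((perF M (dper M (VComp Lc q lam V m κ u))).submatrix fμ fν) := by
  rw [VComp_of_ne_one Lc q lam V hm]
  exact perF_dper_packK_submatrix_slots M fν fμ hν hμ _ κ u

/-- [our object — bookkeeping] (S1)(S2)(S3) for `VComp … m`, `m ≠ 1`. -/
theorem perF_dper_VComp_submatrix_blocks (hm : m ≠ 1)
    (hν : ∀ b : ν, ∃ α : Fin (d + 1), (fν b).2 = Sum.inl α) (hμ : ∀ a : μ, ∃ ρ : Fin (d + 1), (fμ a).2 = Sum.inr ρ)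
    (κ : Fin (d + 1)) (u : Site (d + 1)) :
    (perF M (dper M (VComp Lc q lam V m κ u))).submatrix fν fν = 0 ∧ (perF M (dper M (VComp Lc q lam V m κ u))).submatrix fμ fμ = 0 ∧
      (perF M (dper M (VComp Lc q lam V m κ u))).submatrix fν fμ = ((perF M (dper M (VComp Lc q lam V m κ u))).submatrix fμ fν)ᵀ := by
  rw [VComp_of_ne_one Lc q lam V hm]
  exact ⟨perF_dper_packK_submatrix_field_field M fν hν _ κ u, perF_dper_packK_submatrix_mult_mult M fμ hμ _ κ u,
    perF_dper_packK_submatrix_field_mult M fν fμ _ κ u⟩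

end Record

/-! ## §5 The `fromRows _ 0` words: `kkt`-additivity with static slice rows -/

section Slice

variable {ν μ ρ : Type*}

/-- [folklore] `fromRows` is additive. -/
theorem fromRows_add_add (A A' : Matrix μ ν ℝ) (B B' : Matrix ρ ν ℝ) : fromRows A B + fromRows A' B' = fromRows (A + A') (B + B') := by
  ext (i | i) j <;> rfl

/-- [folklore] `c • fromRows A 0 = fromRows (c • A) 0`. -/
theorem fromRows_smul_zero (c : ℝ) (A : Matrix μ ν ℝ) : c • fromRows A (0 : Matrix ρ ν ℝ) = fromRows (c • A) (0 : Matrix ρ ν ℝ) := by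
  ext (i | i) j
  · rfl
  · simp only [Matrix.smul_apply, fromRows_apply_inr, Matrix.zero_apply, smul_zero]

/-- [folklore] **`kkt_add_slice` — A BORDERED PERTURBATION WITH STATIC SLICE ROWS**: `kkt (H + H') [Q + Q'; τ] = kkt H [Q; τ] + kkt H' [Q'; 0]` — the words
`kkt H₁ (fromRows Q₁₁ 0)`, `kkt H₂ (fromRows Q₁₂ 0)` of the OWNER's step law are the jets of the sliced system whose slice rows do not move. -/
theorem kkt_add_slice (H H' : Matrix ν ν ℝ) (Q Q' : Matrix μ ν ℝ) (τ : Matrix ρ ν ℝ) :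
    kkt (H + H') (fromRows (Q + Q') τ) = kkt H (fromRows Q τ) + kkt H' (fromRows Q' (0 : Matrix ρ ν ℝ)) := by
  rw [← kkt_add, fromRows_add_add, add_zero]

/-- [folklore] `kkt (c • H') [c • Q'; 0] = c • kkt H' [Q'; 0]`. -/
theorem kkt_smul_slice (c : ℝ) (H' : Matrix ν ν ℝ) (Q' : Matrix μ ν ℝ) :
    kkt (c • H') (fromRows (c • Q') (0 : Matrix ρ ν ℝ)) = c • kkt H' (fromRows Q' (0 : Matrix ρ ν ℝ)) := by
  rw [← fromRows_smul_zero, kkt_smul]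

/-- [folklore] **the 2-jet line of a sliced bordered system with static slice rows**:
`kkt (H + (tH₁ + t²H₂)) [Q + (tQ₁ + t²Q₂); τ] = kkt H [Q;τ] + (t • kkt H₁ [Q₁;0] + t² • kkt H₂ [Q₂;0])`. -/
theorem kkt_line_slice (H H₁ H₂ : Matrix ν ν ℝ) (Q Q₁ Q₂ : Matrix μ ν ℝ) (τ : Matrix ρ ν ℝ) (t : ℝ) :
    kkt (H + (t • H₁ + t ^ 2 • H₂)) (fromRows (Q + (t • Q₁ + t ^ 2 • Q₂)) τ)
      = kkt H (fromRows Q τ) + (t • kkt H₁ (fromRows Q₁ (0 : Matrix ρ ν ℝ)) + t ^ 2 • kkt H₂ (fromRows Q₂ (0 : Matrix ρ ν ℝ))) := by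
  rw [kkt_add_slice, kkt_add_slice, kkt_smul_slice, kkt_smul_slice]

end Slice

end Summit.QuantumFields.BalabanUV.Beta.FP.PeriodisedBorderTablesSlots

end
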